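import Summits.AtomisticToContinuum.BoseEinsteinCondensation.Theses.BECDeletionChiSquare
import Literature.MathematicalPhysics.QuantumManyBody.MeanSelfDensity
import Literature.MathematicalPhysics.QuantumManyBody.GroundStateFeynmanKacCutLine
import Literature.MathematicalPhysics.QuantumManyBody.GroundStateFeynmanKacTrialState

/-!
# Line `fk_witness_transfer` — crux `ChiSquareTolerance` (stmt-AtomisticToContinuum-11937) of
# route-AtomisticToContinuum-BECDeletionChiSquare (crux-strategist alternative line; the live
# skeleton `Lines/birth.lean` is untouched)

Crux (the route decl, concluded BY NAME below): for every repulsive finite-range `v` there is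
`ρ₀ > 0` such that for `0 < ρ < ρ₀` there is `C > 0` with: eventually in `n`, for EVERY slack
`δ > 0` SOME `δ`-near-minimiser `Ψ ∈ TrialState (n+1) L`, `L = sideLength ρ (n+1)`, has mean
self-conditional density `m₂(Ψ) = L³ ∫_Y ∫_x |Ψ(x,Y)|⁴ / ∫_x' |Ψ(x',Y)|² ≤ C`
(the inlined term is `BoseGas.meanSelfDensity n L Ψ.ψ` by `rfl`).

## The line: NO GROUND STATE — chi-square tolerance of the finite-`T` Feynman–Kac witnesses,
## uniformly in `T`, transferred to `C¹` near-minimisers by the LANDED witness-transfer machine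

`birth` reaches the crux through the nonnegative ground state `Ψ₀` (existence E + bound B +
recovery R). This line works instead on the CANONICAL, CONSTRUCTIVE states
`Ψ_T := fkWitness v L T 1 = e^{-TH_N}1 / ‖e^{-TH_N}1‖₂` (`GroundStateFeynmanKacCutLine.lean`):
nonnegative, Dirichlet, Bose-symmetric, `L²`-normalised, DEFINED FOR EVERY ADMISSIBLE `v`
(hard cores and `⊤`-shells included — no `E₀`-attainment, no nondegeneracy, no Rellich, no
`IsGroundState` object is ever needed), and `δ`-near-minimising after truncation + mollification
once `T ≳ log(Z₀/Z_T)/δ` (spectral-measure argument). This is exactly the packaging by which the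
sibling route `BECCutLineWeakDisorder` reaches its hinge `LandscapeBound` (stmt-9087) from its
engine `TwoReplicaTransienceBound` (stmt-9687): the transfer `WitnessTransfer` (stmt-14978) is a
TREE THEOREM (`Theorems/BECCutLineWeakDisorderWitnessTransfer.lean`, `WitnessTransfer_of`), and of
its seven parts only (F) `stub_ratio_mollify` and the level-set continuity
`glue_tendsto_ratio_posPart` mention the landscape functional `∫ L³ m²/s²`; parts (B) `stub_heig`,
(C) `stub_envelope`, (E1a) `stub_formBound`, (E1b) `stub_trialState`, (E2) `stub_vanish` and
`glue_eventually_groundStateEnergy_ne_top` (E₀ < ⊤ eventually at low density) are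
functional-independent and importable as they stand.

Why this is a different line and what it buys (see `Lines/fk_witness_transfer.md`):
* the analytic core `stub_fkChiSquareBound` is stated on an explicit one-parameter family where
  the Markov property at the cut, Gaussian domination of the slice and the dyadic
  telescoping/chaining vocabulary of `Cruxes/LandscapeBound/Lines/sibling_telescoping_chaining.lean`
  (LANDED Defs `…LandscapeBoundSiblingDefs/Telescope/Weights/Compose`) apply verbatim with
  `L²`-block masses `p_Q = ∫_Q Ψ²` in place of `L¹`-masses `a_Q = ∫_Q Ψ` — the chi-square is
  monotone under refinement of the block partition (data processing), so `m₂ = sup_ℓ m₂^{(ℓ)}`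
  telescopes over octaves exactly;
* slice Hölder `b³ ≤ S²·A` gives `L³ b²/S² ≤ L³ A/b`, so `stub_fkChiSquareBound` IMPLIES the
  sibling engine `TwoReplicaTransienceBound` (9687) verbatim, and the crux implies
  `LandscapeBound` (9087): one analytic programme now serves two routes (STRATEGY-CENSUS §Transfer);
* birth's stubs E (existence of a nonnegative ground state: `E₀ < ⊤`, `H¹₀`-compactness, Rellich,
  `|Ψ|`-smoothing) and R (recovery of `m₂` FROM ABOVE along good near-minimisers of `Ψ₀`, with the
  component-restriction subtlety for hard cores) are replaced by two `M`-sized measure-theoretic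
  continuity lemmas for `m₂` (truncation, mollification: dominated convergence by `sup|f|²` on the
  finite-measure box, exactly as their landscape twins were proved) and one `L`-sized glue whose
  230-line template is `CutLineWitness.glue_landscape_at`.

Registered stubs (the ONLY `sorry`s of this file):
* `stub_fkChiSquareBound` (HARDEST, open-problem strength — it is where uniformity in `N` lives):
  `∀ v adm ∃ρ₀ ∀ρ∈(0,ρ₀) ∃C>0 ∀ᶠn ∀T≥1, m₂(Ψ_T) ≤ ofReal C` at `L = sideLength ρ (n+1)`.
* `stub_meanSelfDensity_posPart` (F'1, size M): continuity of `m₂` under the level-set truncation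
  `f ↦ (f − η)₊` as `η → 0⁺`, for bounded nonnegative measurable Dirichlet `f` (twin of
  `glue_tendsto_ratio_posPart`).
* `stub_meanSelfDensity_mollify` (F'2, size M): `m₂` moves by `≤ ε` under mollification at
  frequently-small radius, for bounded nonnegative `f` with a support margin (twin of (F)
  `stub_ratio_mollify`; "frequently" because slice-wise `L⁴`/`L²` convergence holds along a
  subsequence of radii).
* `stub_fkTransfer_of_parts` (G', size L): (F'1) → (F'2) → for every admissible `v`, the
  uniform-in-`T` bound transfers to the crux clause at `v` with a NONNEGATIVE witness and
  `C ↦ C + 1` (twin of `stub_landscape_of_parts`/`glue_landscape_at`, all other parts landed).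

Assembly `ChiSquareTolerance_of` (real proof, no `sorry`): feed (F'1), (F'2) and the bound at `v`
into (G'); the crux's inlined double integral is `meanSelfDensity n L Ψ.ψ` definitionally.
-/

namespace Summit.AtomisticToContinuum.BoseEinsteinCondensation.Cruxes.ChiSquareTolerance.FkWitnessTransfer

open MeasureTheory Filter
open scoped ENNReal Topology
open Literature.MathematicalPhysics.QuantumManyBody.BoseGas

/-! ### Statements (audit names `Goal.stub_*`, verbatim the registered stub types) -/

namespace Goal

/-- Statement of the HARDEST stub `stub_fkChiSquareBound`: uniform-in-`T` chi-square deletion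
tolerance of the finite-`T` Feynman–Kac witnesses `Ψ_T = e^{-TH_N}1/‖e^{-TH_N}1‖₂` of the dilute
gas in the Dirichlet box (the `m₂`-twin of `BECCutLineWeakDisorder.TwoReplicaTransienceBound`,
which it implies by slice Hölder). -/
abbrev stub_fkChiSquareBound : Prop :=
    ∀ v : ℝ → ℝ≥0∞, IsRepulsiveFiniteRange v →
      ∃ ρ₀ : ℝ, 0 < ρ₀ ∧ ∀ ρ : ℝ, 0 < ρ → ρ < ρ₀ → ∃ C : ℝ, 0 < C ∧ ∀ᶠ n : ℕ in atTop,
        ∀ T : ℝ, 1 ≤ T →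
          meanSelfDensity n (sideLength ρ (n + 1))
              (fun X => (fkWitness (N := n + 1) v (sideLength ρ (n + 1)) T
                (fun _ => (1 : ℝ≥0∞)) X : ℂ)) ≤ ENNReal.ofReal C

/-- Statement of stub (F'1) `stub_meanSelfDensity_posPart`: continuity of `m₂` under level-set
truncation `η → 0⁺` for bounded nonnegative measurable Dirichlet `f`. -/
abbrev stub_meanSelfDensity_posPart : Prop :=
    ∀ (n : ℕ) (L : ℝ) (f : Config (n + 1) → ℝ), Measurable f → (∃ M : ℝ, ∀ X, |f X| ≤ M) →
      (∀ X, 0 ≤ f X) → (∀ X, X ∉ boxN (n + 1) L → f X = 0) →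
        Tendsto (fun η : ℝ => meanSelfDensity n L (fun X => ((max (f X - η) 0 : ℝ) : ℂ))) (𝓝[>] 0)
          (𝓝 (meanSelfDensity n L (fun X => (f X : ℂ))))

/-- Statement of stub (F'2) `stub_meanSelfDensity_mollify`: `m₂` moves by at most `ε` under
mollification at frequently-small radius, for bounded nonnegative measurable `f` whose support
keeps a margin `r₀` inside the box. -/
abbrev stub_meanSelfDensity_mollify : Prop :=
    ∀ (n : ℕ) (L : ℝ) (f : Config (n + 1) → ℝ), Measurable f → (∃ M : ℝ, ∀ X, |f X| ≤ M) →
      (∀ X, 0 ≤ f X) → ∀ r₀ : ℝ, 0 < r₀ →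
        (∀ X, f X ≠ 0 → Metric.closedBall X r₀ ⊆ boxN (n + 1) L) → ∀ ε : ℝ≥0∞, 0 < ε →
          ∃ᶠ r in 𝓝[>] (0 : ℝ), ∀ hr : 0 < r,
            meanSelfDensity n L (fun X => (mollify hr f X : ℂ)) ≤
              meanSelfDensity n L (fun X => (f X : ℂ)) + ε

/-- The uniform-in-`T` chi-square clause AT a fixed potential `v` (hypothesis shape of (G')). -/
abbrev FkChiSquareClause (v : ℝ → ℝ≥0∞) : Prop :=
    ∃ ρ₀ : ℝ, 0 < ρ₀ ∧ ∀ ρ : ℝ, 0 < ρ → ρ < ρ₀ → ∃ C : ℝ, 0 < C ∧ ∀ᶠ n : ℕ in atTop,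
      ∀ T : ℝ, 1 ≤ T →
        meanSelfDensity n (sideLength ρ (n + 1))
            (fun X => (fkWitness (N := n + 1) v (sideLength ρ (n + 1)) T
              (fun _ => (1 : ℝ≥0∞)) X : ℂ)) ≤ ENNReal.ofReal C

/-- The crux clause AT a fixed potential `v`, with a NONNEGATIVE witness (conclusion shape of (G');
`Ψ.ψ X = ‖Ψ.ψ X‖` is the nonnegativity idiom of `LandscapeBound`). -/
abbrev ChiSquareClauseNonneg (v : ℝ → ℝ≥0∞) : Prop :=
    ∃ ρ₀ : ℝ, 0 < ρ₀ ∧ ∀ ρ : ℝ, 0 < ρ → ρ < ρ₀ → ∃ C : ℝ, 0 < C ∧ ∀ᶠ n : ℕ in atTop,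
      ∀ δ : ℝ≥0∞, 0 < δ →
        ∃ Ψ : TrialState (n + 1) (sideLength ρ (n + 1)),
          energy v Ψ ≤ groundStateEnergy v (n + 1) (sideLength ρ (n + 1)) + δ ∧
            (∀ X, Ψ.ψ X = (‖Ψ.ψ X‖ : ℂ)) ∧
              meanSelfDensity n (sideLength ρ (n + 1)) Ψ.ψ ≤ ENNReal.ofReal C

/-- Statement of stub (G') `stub_fkTransfer_of_parts`: given the two continuity lemmas, the
uniform-in-`T` bound at `v` transfers to the crux clause at `v` (nonnegative witness). -/
abbrev stub_fkTransfer_of_parts : Prop :=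
    stub_meanSelfDensity_posPart → stub_meanSelfDensity_mollify →
      ∀ v : ℝ → ℝ≥0∞, IsRepulsiveFiniteRange v → FkChiSquareClause v → ChiSquareClauseNonneg v

end Goal

/-! ### Registered stubs (the ONLY `sorry`s of this file) -/

/-- Stub (HARDEST, open-problem strength): **uniform-in-`T` chi-square deletion tolerance of the
Feynman–Kac witnesses.** For repulsive finite-range `v` there is `ρ₀ > 0` such that for
`0 < ρ < ρ₀` there is `C > 0` with: eventually in `n`, for all `T ≥ 1`,
`m₂(Ψ_T) = L³ ∫_Y ∫_x Ψ_T(x,Y)⁴/∫_x' Ψ_T(x',Y)² ≤ C`, `Ψ_T = e^{-TH_{n+1}}1/‖·‖₂` in the box of side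
`L = sideLength ρ (n+1)`. Reading: `Ψ_T² dX` is the law of the time-`0` slice of the `2T`-long
`(n+1)`-line system cut in the middle (`lintegral_mul_fkWitness_sq`), and `m₂ − 1 = χ²` of the
tagged endpoint given the bath slice; free Dirichlet gas: product state, `m₂ = L³∫φ_T⁴ ∈ [1, 27/8]`-type product computation.
Expected `1 + O(√(ρa³)) + O(ξ/L)`; implies `TwoReplicaTransienceBound` (9687) by `b³ ≤ S²A`. -/
theorem stub_fkChiSquareBound : Goal.stub_fkChiSquareBound := by
  sorry

/-- Stub (F'1, size M): **`m₂` is continuous under level-set truncation.** For bounded nonnegative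
measurable `f` vanishing off `Λ_L^{n+1}`, `m₂((f−η)₊) → m₂(f)` as `η → 0⁺` (dominated convergence in
`Y` by `sup f²` on the finite-measure box: slice ratio `∫(f−η)₊⁴/∫(f−η)₊² ≤ sup_x (f−η)₊² ≤ M²`, and it
vanishes unless `Y ∈ Λ_Lⁿ`; slice-wise convergence by monotone/dominated convergence in `x`; twin of
`CutLineWitness.glue_tendsto_ratio_posPart`). -/
theorem stub_meanSelfDensity_posPart : Goal.stub_meanSelfDensity_posPart := by
  sorry

/-- Stub (F'2, size M): **`m₂` under mollification.** For bounded nonnegative measurable `f` whose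
support keeps a margin `r₀` inside the box and every `ε > 0`: frequently as `r → 0⁺`,
`m₂(ρ_r ⋆ f) ≤ m₂(f) + ε` (mollification in all `3(n+1)` variables converges in `L²` and `L⁴`;
along a subsequence of radii the slices converge for a.e. `Y`; domination by `sup f²` on the box of
side `L`, support of `ρ_r ⋆ f` inside the box for `r < r₀`; twin of (F) `stub_ratio_mollify`). -/
theorem stub_meanSelfDensity_mollify : Goal.stub_meanSelfDensity_mollify := by
  sorry

/-- Stub (G', size L): **the finite-`T` witness transfer for `m₂`.** Given (F'1) and (F'2), for every
admissible `v` the uniform-in-`T` chi-square clause implies the crux clause with a NONNEGATIVE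
witness (`ρ₀ ↦ min ρ₀ ρ₀'`, `C ↦ C + 1`): at eventual `n` (where `E₀ < ⊤`,
`glue_eventually_groundStateEnergy_ne_top`) and `δ > 0` take `T = max 1 (2ℓ/δ' + 1)` so that the
spectral bound `E_T ≤ E₀ + δ'/4` holds (`stub_heig`, `stub_envelope`), truncate `Ψ_T` at a level
`η` chosen by (F'1) and the box-exit/hard-set vanishing (`glue_wall_vanish`, `stub_vanish`), mollify
(`stub_trialState`, energy by `stub_formBound`) at a radius supplied by (F'2), renormalise
(`meanSelfDensity_const_mul`, `c² ≤ 1 + ε`). Template: `CutLineWitness.glue_landscape_at`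
(Theorems/BECCutLineWeakDisorderWitnessTransferFiniteT.lean) with the two ratio-specific steps
replaced by (F'1)/(F'2). -/
theorem stub_fkTransfer_of_parts : Goal.stub_fkTransfer_of_parts := by
  sorry

/-! ### Proved glue (no `sorry` below this line) -/

/-- Dropping the nonnegativity conjunct and unfolding `meanSelfDensity` (by `rfl`): the nonnegative
clause at `v` gives the crux clause at `v` verbatim. -/
theorem cruxClause_of_nonneg {v : ℝ → ℝ≥0∞} (h : Goal.ChiSquareClauseNonneg v) :
    ∃ ρ₀ : ℝ, 0 < ρ₀ ∧ ∀ ρ : ℝ, 0 < ρ → ρ < ρ₀ → ∃ C : ℝ, 0 < C ∧ ∀ᶠ n : ℕ in Filter.atTop,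
      ∀ δ : ENNReal, 0 < δ →
        ∃ Ψ : TrialState (n + 1) (sideLength ρ (n + 1)),
          energy v Ψ ≤ groundStateEnergy v (n + 1) (sideLength ρ (n + 1)) + δ ∧
            ENNReal.ofReal (sideLength ρ (n + 1) ^ 3) *
                (∫⁻ Y : Config n, ∫⁻ x : Space,
                  (‖Ψ.ψ (Matrix.vecCons x Y)‖₊ : ENNReal) ^ 4 /
                    (∫⁻ x' : Space, (‖Ψ.ψ (Matrix.vecCons x' Y)‖₊ : ENNReal) ^ 2)) ≤
              ENNReal.ofReal C := by
  obtain ⟨ρ₀, hρ₀, H⟩ := h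
  refine ⟨ρ₀, hρ₀, fun ρ hρ hρlt => ?_⟩
  obtain ⟨C, hC, hev⟩ := H ρ hρ hρlt
  refine ⟨C, hC, ?_⟩
  filter_upwards [hev] with n hn δ hδ
  obtain ⟨Ψ, hE, -, hm⟩ := hn δ hδ
  exact ⟨Ψ, hE, by rwa [← meanSelfDensity_eq]⟩

/-! ### The assembly: stubs ⟹ the crux, by name -/

/-- **The composition** `stub_fkChiSquareBound → stub_meanSelfDensity_posPart →
stub_meanSelfDensity_mollify → stub_fkTransfer_of_parts → ChiSquareTolerance` (the route decl, BY
NAME; hypotheses by their audit names `Goal.stub_*`, verbatim the stub statements). -/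
theorem ChiSquareTolerance_of :
    Goal.stub_fkChiSquareBound → Goal.stub_meanSelfDensity_posPart →
      Goal.stub_meanSelfDensity_mollify → Goal.stub_fkTransfer_of_parts →
        Summit.AtomisticToContinuum.BoseEinsteinCondensation.Theses.BECDeletionChiSquare.ChiSquareTolerance := by
  intro hB hP hM hG v hv
  exact cruxClause_of_nonneg (hG hP hM v hv (hB v hv))

/-- The skeleton as a (sorried-through-the-stubs) proof of the crux (D-0027 §3.3 shape): `_of`
applied to the four `stub_*` theorems — also the guard that their types are the `Goal.stub_*`
statements verbatim. -/
theorem ChiSquareTolerance_proof :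
    Summit.AtomisticToContinuum.BoseEinsteinCondensation.Theses.BECDeletionChiSquare.ChiSquareTolerance :=
  ChiSquareTolerance_of stub_fkChiSquareBound stub_meanSelfDensity_posPart
    stub_meanSelfDensity_mollify stub_fkTransfer_of_parts

end Summit.AtomisticToContinuum.BoseEinsteinCondensation.Cruxes.ChiSquareTolerance.FkWitnessTransfer
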